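import Summits.Ventures.PercRepro.RankDistMinor

/-!
# PercRepro — (SC) for every matroid from (SC) on the matroids without a free element (p9, gen 18)

`RankDistMinor` inherits the cumulative shadow inequality `ShadowCumulative` from `M ∖ e` and `M / e` for a
free element `e` (`FreeAt M (q+1) e`). Iterating (strong induction on the size of the ground set) reduces the
candidate conjecture (SC) to two base classes:
* `NoFreeElem M q`: no element of `M` is free at `q` — every non-loop `e` lies in a cocircuit of rank `≤ q` after
  its removal (this class contains `U_{p,p+q}` and every coloop-free matroid on the tight layer `|E| = p + q`);
* the level `q = 0` (bottom sets of rank `0`), which the recursion reaches by contraction and which is not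
  reduced further here.
**`shadowCumulative_of_noFreeElem`**: if (SC) holds at `(p'+1, q'+1)` on every matroid with no element free at
`q'+1` (of rank `p'+1`) and at `(p', 0)` on every matroid of rank `p'`, then it holds at every `(p+1, q+1)` on
every finite matroid of rank `p + 1`. The ranks of the minors: `eRank_delete_of_freeAt` (`ρ(M ∖ e) = ρ(M)`) and
`eRank_contract_add_one` (`ρ(M / e) + 1 = ρ(M)`). Nothing here is a statement about any window of the crux.
-/

namespace PercRepro.RankDist

open Set Finset Matroid PercRepro.ThmH

variable {α : Type}

/-- `NoFreeElem M q`: no element of `M` is free at `q`. -/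
def NoFreeElem (M : Matroid α) (q : ℕ) : Prop := ∀ e : α, ¬ FreeAt M q e

/-- A free element is not a coloop: deleting it keeps the rank. -/
lemma eRank_delete_of_freeAt (M : Matroid α) {q : ℕ} {e : α} (h : FreeAt M q e) :
    (M.delete {e}).eRank = M.eRank := by
  have he : e ∈ M.closure (M.E \ insert e ∅) := h.2 ∅ (empty_subset _) (by simp)
  rw [insert_empty_eq] at he
  rw [← Matroid.eRk_ground, ← Matroid.eRk_ground, Matroid.delete_ground,
    deleteElem_eRk_eq M (subset_refl _), ← eRk_insert_eq_of_mem_closure M he,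
    Set.insert_sdiff_singleton, Set.insert_eq_of_mem h.1.mem_ground]

/-- Contracting a non-loop drops the rank by exactly one. -/
lemma eRank_contract_add_one (M : Matroid α) {e : α} (he : M.IsNonloop e) :
    (M.contract {e}).eRank + 1 = M.eRank := by
  rw [← Matroid.eRk_ground, ← Matroid.eRk_ground, Matroid.contract_ground,
    contractElem_eRk_add_one M he (subset_refl _), Set.insert_sdiff_singleton,
    Set.insert_eq_of_mem he.mem_ground]

variable [DecidableEq α]

/-- **(SC) FOR EVERY MATROID FROM (SC) ON THE MATROIDS WITHOUT A FREE ELEMENT.** If the cumulative shadow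
inequality holds at `(p'+1, q'+1)` on every finite matroid of rank `p'+1` with no element free at `q'+1`, and at
`(p', 0)` on every finite matroid of rank `p'`, then it holds at every `(p+1, q+1)` on every finite matroid of
rank `p+1`. (Strong induction on the size of the ground set through `shadowCumulative_of_delete_contract`.) -/
theorem shadowCumulative_of_noFreeElem
    (H : ∀ (N : Matroid α) [N.Finite] (p' q' : ℕ), NoFreeElem N (q' + 1) → N.eRank = (p' + 1 : ℕ) →
      ShadowCumulative N (p' + 1) (q' + 1))
    (H0 : ∀ (N : Matroid α) [N.Finite] (p' : ℕ), N.eRank = (p' : ℕ) → ShadowCumulative N p' 0)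
    (M : Matroid α) [M.Finite] (p q : ℕ) (hr : M.eRank = (p + 1 : ℕ)) :
    ShadowCumulative M (p + 1) (q + 1) := by
  -- strong induction on the size of the ground set, for all `(p, q)` at once
  suffices key : ∀ n : ℕ, ∀ (N : Matroid α) [N.Finite], N.E.ncard = n → ∀ (p q : ℕ),
      N.eRank = (p + 1 : ℕ) → ShadowCumulative N (p + 1) (q + 1) from key _ M rfl p q hr
  intro n
  induction n using Nat.strong_induction_on with
  | _ n ih =>
    intro N _ hn p q hr
    by_cases hfree : ∃ e : α, FreeAt N (q + 1) e
    · obtain ⟨e, he⟩ := hfree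
      have heE : e ∈ N.E := he.1.mem_ground
      have hlt : (N.E \ {e}).ncard < n := by
        rw [← hn]; exact Set.ncard_sdiff_singleton_lt_of_mem heE N.ground_finite
      -- the deletion side, at the same `(p+1, q+1)`
      have hD : ShadowCumulative (N.delete {e}) (p + 1) (q + 1) :=
        ih _ hlt (N.delete {e}) (by rw [Matroid.delete_ground]) p q
          (by rw [eRank_delete_of_freeAt N he, hr])
      -- the contraction side, at `(p, q)`: the level `q = 0` is the base class `H0`
      have hrC : (N.contract {e}).eRank = (p : ℕ) := by
        have h1 := eRank_contract_add_one N he.1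
        rw [hr] at h1
        exact WithTop.add_right_cancel ENat.one_ne_top (h1.trans (Nat.cast_succ p))
      have hC : ShadowCumulative (N.contract {e}) p q := by
        rcases Nat.eq_zero_or_pos q with rfl | hq
        · exact H0 (N.contract {e}) p hrC
        · obtain ⟨q', rfl⟩ : ∃ q', q = q' + 1 := ⟨q - 1, by omega⟩
          rcases Nat.eq_zero_or_pos p with rfl | hp
          · -- rank `0`: no level `q' + 1 < u < 0`
            intro u hqu hup; omega
          · obtain ⟨p', rfl⟩ : ∃ p', p = p' + 1 := ⟨p - 1, by omega⟩
            exact ih _ hlt (N.contract {e}) (by rw [Matroid.contract_ground]) p' q' hrC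
      exact shadowCumulative_of_delete_contract N he hr hD hC
    · exact H N p q (fun e he => hfree ⟨e, he⟩) hr

variable (M : Matroid α) [M.Finite]

open scoped Classical in
/-- **(SC) at `q = 0`** for a matroid of rank `p`: `s_0·C(p, u) ≤ s_u` — the rank-`0` shadow sets are sets of
loops (each containing the bottom set `∅`), and `A₀ ∪ I` for `I` a `u`-subset of a base is a distinct rank-`u` set
containing `A₀`. -/
theorem shadowCumulative_zero (p : ℕ) (hr : M.eRank = (p : ℕ)) : ShadowCumulative M p 0 := by
  intro u _ _
  rw [Nat.choose_zero_right, mul_one]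
  obtain ⟨β, hβ⟩ := M.exists_isBase
  have hβfin : β.Finite := M.ground_finite.subset hβ.subset_ground
  have hβcard : hβfin.toFinset.card = p := by
    have h1 := hβ.encard_eq_eRank
    rw [hr, ← hβfin.coe_toFinset, Set.encard_coe_eq_coe_finsetCard] at h1
    exact_mod_cast h1
  have hdisj : Disjoint β M.loops := hβ.indep.disjoint_loops
  let f : Set α × Finset α → Set α := fun x => x.1 ∪ (x.2 : Set α)
  -- membership of the product in the level-`u` shadow
  have hmaps : ∀ x ∈ shadowLev M 0 (PerFlat.Uq M p 0) ×ˢ hβfin.toFinset.powersetCard u,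
      f x ∈ shadowLev M u (PerFlat.Uq M p 0) := by
    rintro ⟨A₀, I⟩ hx
    rw [Finset.mem_product, mem_shadowLev, Finset.mem_powersetCard] at hx
    dsimp only at hx
    obtain ⟨⟨hA₀E, hA₀0, B, hB, hBA⟩, hIβ, hIu⟩ := hx
    have hIβ' : (I : Set α) ⊆ β := by
      intro x hx; rw [← hβfin.coe_toFinset]; exact_mod_cast hIβ hx
    have hIE : (I : Set α) ⊆ M.E := hIβ'.trans hβ.subset_ground
    have hA₀loops : A₀ ⊆ M.loops := by
      have h0 : M.eRk A₀ = 0 := by have := (rk_eq_iff M hA₀E 0).1 hA₀0; exact_mod_cast this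
      exact (Matroid.eRk_eq_zero_iff hA₀E).1 h0
    have hIind : M.Indep (I : Set α) := hβ.indep.subset hIβ'
    have hrk : M.eRk (A₀ ∪ (I : Set α)) = (u : ℕ) := by
      apply le_antisymm
      · calc M.eRk (A₀ ∪ (I : Set α)) ≤ M.eRk (M.closure (I : Set α)) := by
              apply M.eRk_mono
              apply Set.union_subset
              · exact hA₀loops.trans (by rw [← M.closure_empty]; exact M.closure_mono (empty_subset _))
              · exact M.subset_closure _ hIE
          _ = (u : ℕ) := by
              rw [M.eRk_closure_eq, hIind.eRk_eq_encard, Set.encard_coe_eq_coe_finsetCard, hIu]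
      · calc (u : ℕ∞) = M.eRk (I : Set α) := by
              rw [hIind.eRk_eq_encard, Set.encard_coe_eq_coe_finsetCard, hIu]
          _ ≤ M.eRk (A₀ ∪ (I : Set α)) := M.eRk_mono subset_union_right
    show A₀ ∪ (I : Set α) ∈ shadowLev M u (PerFlat.Uq M p 0)
    rw [mem_shadowLev]
    refine ⟨Set.union_subset hA₀E hIE, (rk_eq_iff M (Set.union_subset hA₀E hIE) u).2 hrk, B, hB,
      hBA.trans subset_union_left⟩
  -- injectivity on the product
  have hinj : Set.InjOn f ↑(shadowLev M 0 (PerFlat.Uq M p 0) ×ˢ hβfin.toFinset.powersetCard u) := by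
    rintro ⟨A₀, I⟩ hx ⟨A₀', I'⟩ hx' hxx
    rw [Finset.mem_coe, Finset.mem_product, mem_shadowLev, Finset.mem_powersetCard] at hx hx'
    dsimp only at hx hx'
    obtain ⟨⟨hA₀E, hA₀0, -⟩, hIβ, -⟩ := hx
    obtain ⟨⟨hA₀E', hA₀0', -⟩, hIβ', -⟩ := hx'
    have hA₀loops : A₀ ⊆ M.loops := by
      have h0 : M.eRk A₀ = 0 := by have := (rk_eq_iff M hA₀E 0).1 hA₀0; exact_mod_cast this
      exact (Matroid.eRk_eq_zero_iff hA₀E).1 h0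
    have hA₀loops' : A₀' ⊆ M.loops := by
      have h0 : M.eRk A₀' = 0 := by have := (rk_eq_iff M hA₀E' 0).1 hA₀0'; exact_mod_cast this
      exact (Matroid.eRk_eq_zero_iff hA₀E').1 h0
    have hIβs : (I : Set α) ⊆ β := by
      intro x hx; rw [← hβfin.coe_toFinset]; exact_mod_cast hIβ hx
    have hIβs' : (I' : Set α) ⊆ β := by
      intro x hx; rw [← hβfin.coe_toFinset]; exact_mod_cast hIβ' hx
    have key : ∀ (A : Set α) (J : Finset α), A ⊆ M.loops → (J : Set α) ⊆ β →
        (A ∪ (J : Set α)) ∩ M.loops = A ∧ (A ∪ (J : Set α)) ∩ β = (J : Set α) := by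
      intro A J hA hJ
      constructor
      · rw [Set.union_inter_distrib_right, Set.inter_eq_left.2 hA,
          (hdisj.mono_left hJ).inter_eq, Set.union_empty]
      · rw [Set.union_inter_distrib_right, Set.inter_eq_left.2 hJ,
          (hdisj.symm.mono_left hA).inter_eq, Set.empty_union]
    have hxx' : A₀ ∪ (I : Set α) = A₀' ∪ (I' : Set α) := hxx
    obtain ⟨k1, k2⟩ := key A₀ I hA₀loops hIβs
    obtain ⟨k1', k2'⟩ := key A₀' I' hA₀loops' hIβs'
    have e1 : A₀ = A₀' := by rw [← k1, ← k1', hxx']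
    have e2 : I = I' := by
      apply Finset.coe_injective
      rw [← k2, ← k2', hxx']
    rw [e1, e2]
  calc (shadowLev M 0 (PerFlat.Uq M p 0)).card * p.choose u
      = (shadowLev M 0 (PerFlat.Uq M p 0) ×ˢ hβfin.toFinset.powersetCard u).card := by
        rw [Finset.card_product, Finset.card_powersetCard, hβcard]
    _ = ((shadowLev M 0 (PerFlat.Uq M p 0) ×ˢ hβfin.toFinset.powersetCard u).image f).card :=
        (Finset.card_image_of_injOn hinj).symm
    _ ≤ (shadowLev M u (PerFlat.Uq M p 0)).card := by
        apply Finset.card_le_card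
        intro y hy
        obtain ⟨x, hx, rfl⟩ := Finset.mem_image.1 hy
        exact hmaps x hx

/-- **(SC) FOR EVERY MATROID FROM (SC) ON THE MATROIDS WITHOUT A FREE ELEMENT — the base level `q = 0`
discharged.** -/
theorem shadowCumulative_of_noFreeElem'
    (H : ∀ (N : Matroid α) [N.Finite] (p' q' : ℕ), NoFreeElem N (q' + 1) → N.eRank = (p' + 1 : ℕ) →
      ShadowCumulative N (p' + 1) (q' + 1))
    (p q : ℕ) (hr : M.eRank = (p + 1 : ℕ)) : ShadowCumulative M (p + 1) (q + 1) :=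
  shadowCumulative_of_noFreeElem H (fun N _ p' hr' => shadowCumulative_zero N p' hr') M p q hr

end PercRepro.RankDist
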